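import Summits.AtomisticToContinuum.HydrodynamicLimit.Theses.MourreKoopmanCharges
import Summits.AtomisticToContinuum.HydrodynamicLimit.Theorems.MourreKoopmanChargesLinearToEntropyInBandDefsB
import HarnessLib

/-!
# `LinearToEntropyInBand` — item-level SPLIT glue (strategist, `cstrat-stmt-AtomisticToContinuum-17740`)

The crux `MourreKoopmanCharges.LinearToEntropyInBand` (stmt-17740) is, by `rfl`,
`OneBodyCompleteness → StressStrongMixing → RelEntropyVanishingInBand`.  The registered line
(`Cruxes/LinearToEntropyInBand/Lines/birth.lean`, v7) factors every proof of it through three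
mathematically independent pieces, typed over the landed objects of
`MourreKoopmanChargesLinearToEntropyInBandDefs{,B}`:

* `Sub₁ := LTEInBand.VisibleFluxGibbsianity` — the EQUILIBRIUM large-deviation heart: the scaled
  modified-ensemble pressure of the time-integrated, VISIBILITY-cut microscopic flux excesses vanishes in
  the Euler window, in the reduced-density band (the repair of the refuted un-cut stmt-13021).  It is filed
  BARE: the strategist's census (`Cruxes/LinearToEntropyInBand/STRATEGY-CENSUS.md`) records why the two
  `n = 2` Koopman hypotheses cannot be load-bearing for a statement about all orders of the pressure, so
  the honest node is the pressure statement itself (the hypothesis-form stays available on the parent).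
* `Sub₂ := LTEInBand.VisibleFluxGibbsianity → LTEInBand.VisibleOneBlockEstimateInBand` — the ball-wise
  LOCALISATION (the lead's stub 4a-i, AUDIT-4a: splice law on escape-free configurations, ball-marginal
  entropy subadditivity, frozen-reference mismatch `O(N r₁²) + o(N)`, `L¹` window locality, tilted LD
  bound under the time-dependent local-Gibbs reference, packaged through the splice of the TRUE law).
* `Sub₃ := LTEInBand.VisibleOneBlockEstimateInBand → RelEntropyVanishingInBand` — the ENTROPY CLOSURE:
  Yau's bookkeeping with the visible/invisible split (stub 4a-ii) together with the true-law inputs it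
  consumes (energy-current tails in band, the Lanford envelope, invisible-collision throughput, weighted
  coherent-suprathermal content) and the landed dock S1–S5.

This file proves only the (trivial) composition, stated with the crux BY NAME, so that the route's
tenure edit `--split LinearToEntropyInBand --into Sub₁ Sub₂ Sub₃ --glue-by LinearToEntropyInBand_of_subs`
has a landed glue theorem.  No statement of the route is touched.
-/

namespace Summit.AtomisticToContinuum.HydrodynamicLimit.Theorems.LTEInBand

open Summit.AtomisticToContinuum.HydrodynamicLimit.Theses

/-- **Split glue (kernel-checked, no `sorry`)**: visible flux-Gibbsianity, its ball-wise localisation to the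
visible one-block estimate in band, and the entropy closure of that estimate together give the crux
`MourreKoopmanCharges.LinearToEntropyInBand` — whatever the status of the two Koopman hypotheses, which the
crux takes as antecedents and this composition does not need. -/
theorem LinearToEntropyInBand_of_subs :
    VisibleFluxGibbsianity →
    (VisibleFluxGibbsianity → VisibleOneBlockEstimateInBand) →
    (VisibleOneBlockEstimateInBand → MourreKoopmanCharges.RelEntropyVanishingInBand) →
    MourreKoopmanCharges.LinearToEntropyInBand :=
  fun hA hB hC _ _ => hC (hB hA)

/-- The same composition with the hypothesis-form of the first piece (the lead's stub 1 of
`Lines/birth.lean`): recorded so that a proof of `OneBodyCompleteness → StressStrongMixing →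
VisibleFluxGibbsianity` also discharges the split. -/
theorem LinearToEntropyInBand_of_subs' :
    (MourreKoopmanCharges.OneBodyCompleteness → MourreKoopmanCharges.StressStrongMixing →
      VisibleFluxGibbsianity) →
    (VisibleFluxGibbsianity → VisibleOneBlockEstimateInBand) →
    (VisibleOneBlockEstimateInBand → MourreKoopmanCharges.RelEntropyVanishingInBand) →
    MourreKoopmanCharges.LinearToEntropyInBand :=
  fun hA hB hC h₁ h₂ => hC (hB (hA h₁ h₂))

/-- Sanity (by `rfl`): the crux is literally the hypothesis-form of the shared guarded target. -/
example : MourreKoopmanCharges.LinearToEntropyInBand =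
    (MourreKoopmanCharges.OneBodyCompleteness → MourreKoopmanCharges.StressStrongMixing →
      MourreKoopmanCharges.RelEntropyVanishingInBand) := rfl

end Summit.AtomisticToContinuum.HydrodynamicLimit.Theorems.LTEInBand
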